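import Summits.Ventures.PercRepro.Night2FatXElevenGeneric

/-!
# night-2: generic off-points alone close `|G| ≤ 11` — the top three levels are unloaded

With generic off-points (no three-point line of `V` coplanar with `w₀, x`) there is no distance-2 load, so a loaded
target has `rk (G ∖ T) ≥ 3`: **the top three levels of every basis pair are unloaded**
(`dload_eq_zero_of_card_sdiff_le_two_of_generic`).  At `N = 5` this puts every load at level `2`, and the count of
`basis_pair_fair_fat_of_lines_le_three_of_generic_five` goes through without any hypothesis on the lines of `V`
(`basis_pair_fair_fat_of_generic_five`): **`localShadowHall_fat_of_generic_of_card_le_eleven`** — the (2,1) cell with a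
fat closure and generic off-points satisfies the local Hall inequality for `|G| ≤ 11`.
Paper `proofs/NIGHT-2-g33.md` §6 (e).
-/

namespace PercRepro.Shadow

open PercRepro.ThmH PercRepro.PerFlat

variable {α : Type*} [DecidableEq α] {M : Matroid α} [M.Finite] {G : Finset α}

/-- **With generic off-points a target missing at most two points of `G` is unloaded**: a distance-1 load needs
`rk (G ∖ T) ≥ 3`, and there is no distance-2 load. -/
theorem dload_eq_zero_of_card_sdiff_le_two_of_generic (hG : G ∈ flatsQ M (5 + 1)) (hd : (gr M \ G).card = 2)
    (hk : kColoops M G = 1) (hs : ∀ e ∈ gr M, ∀ f ∈ gr M, e ≠ f → rkN M {e, f} = 2)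
    (hl : ∀ e ∈ gr M, M.Indep {e}) (hfat : (fatClosures M 5 G 2).card ≤ 1) {B₀ : Finset α}
    (hB₀ : B₀ ∈ thinMembers M 5 G) {w₀ x : α} (hD : G \ clF M B₀ = {w₀, x})
    (hgen : ∀ R ⊆ G \ coloops M G, rkN M R = 2 → 3 ≤ R.card → 4 ≤ rkN M (insert w₀ (insert x R)))
    {T : Finset α} (hTG : T ⊆ G) (h2 : (G \ T).card ≤ 2) : dload M 5 G (bigP M G) (dshGT2 M 5 G) T = 0 := by
  by_contra hload
  obtain ⟨R, hR, hR2, hR3, hcase⟩ := loaded_fat_target_dichotomy hG hd hk hs hl hfat hB₀ hD hTG hload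
  rcases hcase with ⟨-, hrk⟩ | ⟨-, hcop⟩
  · have := rkN_le_card (M := M) (G \ T)
    omega
  · have hRV : R ⊆ G \ coloops M G := fun r hr =>
      Finset.sdiff_subset_sdiff hTG (Finset.Subset.refl _) (Finset.mem_sdiff.1 (hR hr)).1
    have := hgen R hRV hR2 hR3
    omega

open scoped Classical in
/-- **The fat case of (FAIR) at `N = 5` with generic off-points** (no hypothesis on the lines of `V`). -/
theorem basis_pair_fair_fat_of_generic_five (hG : G ∈ flatsQ M (5 + 1))
    (hd : (gr M \ G).card = 2) (hk : kColoops M G = 1)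
    (hs : ∀ e ∈ gr M, ∀ f ∈ gr M, e ≠ f → rkN M {e, f} = 2) (hl : ∀ e ∈ gr M, M.Indep {e})
    (hfat : (fatClosures M 5 G 2).card ≤ 1) {B₀ : Finset α} (hB₀ : B₀ ∈ thinMembers M 5 G) {w₀ x : α}
    (hD : G \ clF M B₀ = {w₀, x}) (hne : w₀ ≠ x)
    (hgen : ∀ R ⊆ G \ coloops M G, rkN M R = 2 → 3 ≤ R.card → 4 ≤ rkN M (insert w₀ (insert x R)))
    {B : Finset α} (hB : B ∈ thinMembers M 5 G) (hnP : ¬ bigP M G B) {z : α} (hz : z ∈ G \ clF M B)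
    (hl0 : loss M 5 G B z ≠ 0) (hw₀ : w₀ ∈ insert z B) (hx : x ∉ insert z B) (hN : (G \ insert z B).card = 5) :
    loss M 5 G B z ≤ rhoL M 5 G B z * lossIncomeH M 5 G (bigP M G) (dshGT2 M 5 G) B z := by
  have hd' : (gr M \ G).card ≤ 5 := by omega
  have hGg : G ⊆ gr M := (mem_flatsQ.1 hG).1
  have hQG : insert z B ⊆ G :=
    Finset.insert_subset (Finset.mem_sdiff.1 hz).1 (subset_G_of_mem_thinMembers hB)
  have hBm : B ∈ membersIn M (Uq M (5 + 2) 5) G := (mem_thinMembers.1 hB).1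
  have hxG : x ∈ G \ insert z B := by
    refine Finset.mem_sdiff.2 ⟨?_, hx⟩
    have : x ∈ G \ clF M B₀ := by
      rw [hD]
      exact Finset.mem_insert_of_mem (Finset.mem_singleton_self _)
    exact (Finset.mem_sdiff.1 this).1
  have hw₀K : w₀ ∉ coloops M G := by
    intro h'
    have h1 : w₀ ∈ clF M B₀ := subset_clF_of_subset_gr ((subset_G_of_mem_thinMembers hB₀).trans hGg)
      (coloops_subset_of_mem_thinMembers hG hd' hB₀ h')
    have h2 : w₀ ∈ G \ clF M B₀ := by
      rw [hD]
      exact Finset.mem_insert_self _ _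
    exact (Finset.mem_sdiff.1 h2).2 h1
  have hw₀' : w₀ ∈ insert z B \ coloops M G := Finset.mem_sdiff.2 ⟨hw₀, hw₀K⟩
  -- every load is at level `2`: level `1` has six points off `K`, the levels `3, 4, 5` miss at most two points
  have hlev2 : ∀ T ∈ tgtSets M 5 G B z, (T \ insert z B).card ≠ 2 →
      dload M 5 G (bigP M G) (dshGT2 M 5 G) T = 0 := by
    intro T hT h2
    have hTG : T ⊆ G := subset_G_of_mem_shadowAt (mem_tgtSets.1 hT).1
    have hGT := card_sdiff_add_card_sdiff_of_mem_tgtSets hT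
    have hlev := card_sdiff_coloops_eq_level_add_five hG hd hk hB hnP hz hT
    rcases Nat.lt_or_ge (T \ insert z B).card 2 with h1 | h3
    · exact dload_eq_zero_of_card_sdiff_le_six hG hd hk hs hl (by omega)
    · exact dload_eq_zero_of_card_sdiff_le_two_of_generic hG hd hk hs hl hfat hB₀ hD hgen hTG (by omega)
  apply basis_pair_fair_of_fat_indep_sum hG hd hk hs hl hfat hB₀ hD hne hB hnP hz hl0 hw₀ hx
  have hg0 : ∀ T ∈ (tgtSets M 5 G B z).filter
      (fun T => x ∈ T ∧ dload M 5 G (bigP M G) (dshGT2 M 5 G) T = 0),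
      0 ≤ capS M 5 G T / ((221 / 360 : ℚ) *
        ((2 * ((((T \ coloops M G) \ {w₀, x}).powersetCard 4).filter
          (fun F : Finset α => M.Indep (↑F : Set α))).card : ℕ) : ℚ)) :=
    fun T _ => div_nonneg (capS_nonneg' hG hd' T) (by positivity)
  have hsum := sum_levels_le_sum hg0 (fun T => (T \ insert z B).card) {1, 2, 3, 4, 5}
  rw [Finset.sum_insert (by decide), Finset.sum_insert (by decide), Finset.sum_insert (by decide),
    Finset.sum_insert (by decide), Finset.sum_singleton] at hsum
  have hX1 : ({x} : Finset α) ⊆ G \ insert z B := Finset.singleton_subset_iff.2 hxG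
  -- the generic bound `I₄ ≤ C(j + 3, 4)` at every target
  have hbound : ∀ (I : ℕ) (j : ℕ), ((j + 3).choose 4 ≤ I) → ∀ T ∈ tgtSets M 5 G B z, ({x} : Finset α) ⊆ T →
      (T \ insert z B).card = j → ((((T \ coloops M G) \ {w₀, x}).powersetCard 4).filter
        (fun F : Finset α => M.Indep (↑F : Set α))).card ≤ I := by
    intro I j hIj T hT hxT hTj
    have hw₀T : w₀ ∈ T := (mem_tgtSets.1 hT).2.1 hw₀
    have := indep_count_le_choose hG hd hk hB₀ hD hne hB hnP hz hT hw₀T (Finset.singleton_subset_iff.1 hxT)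
    rw [hTj] at this
    omega
  -- level 1
  have hl1 := fat_indep_level_ge_of_bound hG hd hk hB hnP hz hw₀' hx hX1 (Finset.mem_singleton_self _)
    (j := 1) (by norm_num) (by simp) (I := 1) (by norm_num)
    (fun T hT _ h1 => hlev2 T hT (by omega)) (hbound 1 1 (by decide))
  -- level 3 (crude), 4, 5
  have hl3 := fat_indep_level_ge_of_bound hG hd hk hB hnP hz hw₀' hx hX1 (Finset.mem_singleton_self _)
    (j := 3) (by norm_num) (by simp) (I := 15) (by norm_num)
    (fun T hT _ h3 => hlev2 T hT (by omega)) (hbound 15 3 (by decide))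
  have hl4 := fat_indep_level_ge_of_bound hG hd hk hB hnP hz hw₀' hx hX1 (Finset.mem_singleton_self _)
    (j := 4) (by norm_num) (by simp) (I := 35) (by norm_num)
    (fun T hT _ h4 => hlev2 T hT (by omega)) (hbound 35 4 (by decide))
  have hl5 := fat_indep_level_ge_of_bound hG hd hk hB hnP hz hw₀' hx hX1 (Finset.mem_singleton_self _)
    (j := 5) (by norm_num) (by simp) (I := 70) (by norm_num)
    (fun T hT _ h5 => hlev2 T hT (by omega)) (hbound 70 5 (by decide))
  have hl2nonneg : 0 ≤ ∑ T ∈ ((tgtSets M 5 G B z).filter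
      (fun T => x ∈ T ∧ dload M 5 G (bigP M G) (dshGT2 M 5 G) T = 0)).filter
      (fun T => (T \ insert z B).card = 2),
      capS M 5 G T / ((221 / 360 : ℚ) *
        ((2 * ((((T \ coloops M G) \ {w₀, x}).powersetCard 4).filter
          (fun F : Finset α => M.Indep (↑F : Set α))).card : ℕ) : ℚ)) :=
    Finset.sum_nonneg (fun T hT => hg0 T (Finset.mem_filter.1 hT).1)
  rw [hN] at hl1 hl3 hl4 hl5
  simp only [Finset.card_singleton] at hl1 hl3 hl4 hl5
  push_cast at hsum hl1 hl3 hl4 hl5 hl2nonneg ⊢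
  norm_num [Nat.choose] at hl1 hl3 hl4 hl5
  by_cases hall : ∀ y ∈ (G \ insert z B).erase x,
      dload M 5 G (bigP M G) (dshGT2 M 5 G) (insert z B ∪ {x, y}) ≠ 0
  · -- every level-2 target is loaded: every level-3 target carries a three-point line, `I₄ ≤ 12`
    have hl3' := fat_indep_level_ge_of_bound hG hd hk hB hnP hz hw₀' hx hX1 (Finset.mem_singleton_self _)
      (j := 3) (by norm_num) (by simp) (I := 12) (by norm_num)
      (fun T hT _ h3 => hlev2 T hT (by omega)) ?_
    · rw [hN] at hl3'
      simp only [Finset.card_singleton] at hl3'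
      push_cast at hl3'
      norm_num [Nat.choose] at hl3'
      linarith
    · intro T hT hxT hT3
      have hxT' : x ∈ T := Finset.singleton_subset_iff.1 hxT
      have hw₀T : w₀ ∈ T := (mem_tgtSets.1 hT).2.1 hw₀
      have hQT : insert z B ⊆ T := (mem_tgtSets.1 hT).2.1
      have hTG : T ⊆ G := subset_G_of_mem_shadowAt (mem_tgtSets.1 hT).1
      -- a point `y ≠ x` of `T ∖ Q`
      have hYc : ((T \ insert z B).erase x).card = 2 := by
        rw [Finset.card_erase_of_mem (Finset.mem_sdiff.2 ⟨hxT', hx⟩), hT3]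
      obtain ⟨y, hy⟩ : ((T \ insert z B).erase x).Nonempty := by
        rw [← Finset.card_pos, hYc]
        norm_num
      have hyx : y ≠ x := (Finset.mem_erase.1 hy).1
      have hyTQ : y ∈ T \ insert z B := (Finset.mem_erase.1 hy).2
      have hyG : y ∈ (G \ insert z B).erase x :=
        Finset.mem_erase.2 ⟨hyx, Finset.mem_sdiff.2 ⟨hTG (Finset.mem_sdiff.1 hyTQ).1, (Finset.mem_sdiff.1 hyTQ).2⟩⟩
      -- the level-2 target `Q ∪ {x, y}` is loaded
      have hT₂ : insert z B ∪ {x, y} ∈ tgtSets M 5 G B z := by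
        rw [tgtSets_eq_image hG hBm hz, Finset.mem_image]
        refine ⟨{x, y}, Finset.mem_filter.2 ⟨Finset.mem_powerset.2 ?_, ⟨x, Finset.mem_insert_self _ _⟩⟩, rfl⟩
        intro e he
        rw [Finset.mem_insert, Finset.mem_singleton] at he
        rcases he with rfl | rfl
        · exact hxG
        · exact Finset.mem_of_mem_erase hyG
      have hT₂x : x ∈ insert z B ∪ {x, y} := Finset.mem_union_right _ (Finset.mem_insert_self _ _)
      have hT₂sd : (insert z B ∪ {x, y}) \ insert z B = {x, y} := by
        rw [Finset.union_sdiff_left]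
        apply Finset.sdiff_eq_self_of_disjoint
        rw [Finset.disjoint_left]
        intro e he
        rw [Finset.mem_insert, Finset.mem_singleton] at he
        rcases he with rfl | rfl
        · exact hx
        · exact (Finset.mem_sdiff.1 (Finset.mem_of_mem_erase hyG)).2
      have hT₂c : ((insert z B ∪ {x, y}) \ insert z B).card = 2 := by
        rw [hT₂sd]
        exact Finset.card_pair hyx.symm
      obtain ⟨⟨a, ha, b, hb, hab, hrk⟩, -⟩ := exists_basis_line_of_loaded_level_two_fat hG hd hk hs hl hfat hB₀
        hD hB hnP hz hT₂ hT₂x hx hT₂c (hall y hyG)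
      rw [hT₂sd, Finset.erase_insert (by rw [Finset.mem_singleton]; exact hyx.symm)] at hrk
      -- the three-point line `{a, b, y}` lies in `P_T`
      have hR : ({a, b, y} : Finset α) ⊆ (T \ coloops M G) \ {w₀, x} := by
        intro e he
        rw [Finset.mem_insert, Finset.mem_insert, Finset.mem_singleton] at he
        have hab' : ∀ c ∈ (insert z B \ coloops M G).erase w₀, c ∈ (T \ coloops M G) \ {w₀, x} := by
          intro c hc
          rw [Finset.mem_erase, Finset.mem_sdiff] at hc
          rw [Finset.mem_sdiff, Finset.mem_sdiff, Finset.mem_insert, Finset.mem_singleton]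
          refine ⟨⟨hQT hc.2.1, hc.2.2⟩, ?_⟩
          rintro (h' | h')
          · exact hc.1 h'
          · exact hx (h' ▸ hc.2.1)
        rcases he with rfl | rfl | rfl
        · exact hab' e ha
        · exact hab' e hb
        · rw [Finset.mem_sdiff, Finset.mem_sdiff, Finset.mem_insert, Finset.mem_singleton]
          refine ⟨⟨(Finset.mem_sdiff.1 hyTQ).1, fun h' => (Finset.mem_sdiff.1 hyTQ).2
            ((coloops_subset_of_mem_thinMembers hG hd' hB).trans (Finset.subset_insert _ _) h')⟩, ?_⟩
          rintro (h' | h')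
          · exact (Finset.mem_sdiff.1 hyTQ).2 (h' ▸ hw₀)
          · exact hyx h'
      have hcard3 : ({a, b, y} : Finset α).card = 3 := by
        rw [Finset.card_insert_of_notMem, Finset.card_pair]
        · intro h'
          exact (Finset.mem_sdiff.1 hyTQ).2 (Finset.mem_of_mem_erase hb |> fun h'' => h' ▸ (Finset.mem_sdiff.1 h'').1)
        · rw [Finset.mem_insert, Finset.mem_singleton, not_or]
          exact ⟨hab, fun h' => (Finset.mem_sdiff.1 hyTQ).2 (h' ▸ (Finset.mem_sdiff.1 (Finset.mem_of_mem_erase ha)).1)⟩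
      have := card_indep_four_le_of_line_target hG hd hk hB₀ hD hne hB hnP hz hT hw₀T hxT' hR hrk
      rw [hcard3, hT3] at this
      norm_num [Nat.choose] at this
      omega
  · -- some level-2 target is unloaded: it contributes `36/221`
    obtain ⟨y₀, hy₀, hy₀load⟩ : ∃ y₀ ∈ (G \ insert z B).erase x,
        dload M 5 G (bigP M G) (dshGT2 M 5 G) (insert z B ∪ {x, y₀}) = 0 := by
      by_contra hcon
      apply hall
      intro y hy hy0
      exact hcon ⟨y, hy, hy0⟩
    have hy₀x : y₀ ≠ x := (Finset.mem_erase.1 hy₀).1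
    have hy₀G : y₀ ∈ G \ insert z B := Finset.mem_of_mem_erase hy₀
    have hX2 : ({x, y₀} : Finset α) ⊆ G \ insert z B := by
      intro e he
      rw [Finset.mem_insert, Finset.mem_singleton] at he
      rcases he with rfl | rfl
      · exact hxG
      · exact hy₀G
    have hX2c : ({x, y₀} : Finset α).card = 2 := Finset.card_pair hy₀x.symm
    have hl2 := fat_indep_level_ge_of_bound hG hd hk hB hnP hz hw₀' hx hX2 (Finset.mem_insert_self _ _)
      (j := 2) (by norm_num) (by rw [hX2c]) (I := 5) (by norm_num) ?_ ?_
    · rw [hN, hX2c] at hl2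
      push_cast at hl2
      norm_num [Nat.choose] at hl2
      linarith
    · -- the only target above `Q ∪ {x, y₀}` at level `2` is `Q ∪ {x, y₀}`
      intro T hT hXT hT2
      have hQT : insert z B ⊆ T := (mem_tgtSets.1 hT).2.1
      have hsub : ({x, y₀} : Finset α) ⊆ T \ insert z B := by
        intro e he
        exact Finset.mem_sdiff.2 ⟨hXT he, (Finset.mem_sdiff.1 (hX2 he)).2⟩
      have heq : T \ insert z B = {x, y₀} := (Finset.eq_of_subset_of_card_le hsub (by rw [hT2, hX2c])).symm
      have hT' : T = insert z B ∪ {x, y₀} := by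
        rw [← heq]
        exact (Finset.union_sdiff_of_subset hQT).symm
      rw [hT']
      exact hy₀load
    · intro T hT hXT hT2
      have hw₀T : w₀ ∈ T := (mem_tgtSets.1 hT).2.1 hw₀
      have := indep_count_le_choose hG hd hk hB₀ hD hne hB hnP hz hT hw₀T (hXT (Finset.mem_insert_self _ _))
      rw [hT2] at this
      exact this

/-- **The (2,1) cell with a fat closure and generic off-points, `|G| ≤ 11`.** -/
theorem localShadowHall_fat_of_generic_of_card_le_eleven (hG : G ∈ flatsQ M (5 + 1))
    (hd : (gr M \ G).card = 2) (hk : kColoops M G = 1)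
    (hs : ∀ e ∈ gr M, ∀ f ∈ gr M, e ≠ f → rkN M {e, f} = 2) (hl : ∀ e ∈ gr M, M.Indep {e})
    (hfat : (fatClosures M 5 G 2).card ≤ 1) {B₀ : Finset α} (hB₀ : B₀ ∈ thinMembers M 5 G)
    (hm₀ : (G \ clF M B₀).card = 2)
    (hgen : ∀ R ⊆ G \ coloops M G, rkN M R = 2 → 3 ≤ R.card → 4 ≤ rkN M (R ∪ (G \ clF M B₀)))
    (hG11 : G.card ≤ 11) : LocalShadowHall M 5 G := by
  apply localShadowHall_of_gt2_of_basis_fair hG hd hk hs hl hfat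
  intro B hB hnP z hz
  have hd' : (gr M \ G).card ≤ 5 := by omega
  by_cases hl0 : loss M 5 G B z = 0
  · rw [hl0]
    have h1 : 0 ≤ rhoL M 5 G B z := by
      unfold rhoL
      rw [hl0]
      simp
    have h2 : 0 ≤ lossIncomeH M 5 G (bigP M G) (dshGT2 M 5 G) B z :=
      lossIncomeH_nonneg hG hd' (column_side_gt2 hG hd hk hs hl hfat) B z
    positivity
  · obtain ⟨w₀, x, hD, hne, hw₀, hx⟩ := exists_fat_split hG hd hk hB₀ hm₀ hB hz hl0
    have hgen' : ∀ R ⊆ G \ coloops M G, rkN M R = 2 → 3 ≤ R.card → 4 ≤ rkN M (insert w₀ (insert x R)) := by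
      intro R hR hR2 hR3
      have := hgen R hR hR2 hR3
      rw [hD] at this
      have heq : R ∪ ({w₀, x} : Finset α) = insert w₀ (insert x R) := by
        ext e
        simp only [Finset.mem_union, Finset.mem_insert, Finset.mem_singleton]
        tauto
      rw [heq] at this
      exact this
    have hN4 := four_le_card_sdiff_insert hG hd hB hz
    have hN : (G \ insert z B).card ≤ 5 := by
      have hQG : insert z B ⊆ G :=
        Finset.insert_subset (Finset.mem_sdiff.1 hz).1 (subset_G_of_mem_thinMembers hB)
      have hKQ : coloops M G ⊆ insert z B :=
        (coloops_subset_of_mem_thinMembers hG hd' hB).trans (Finset.subset_insert _ _)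
      have hQ5 := card_insert_sdiff_eq_five hG hd hk hB hnP hz
      have h1 := Finset.card_sdiff_add_card_eq_card hKQ
      rw [← kColoops_eq_card_coloops, hk, hQ5] at h1
      have h2 := Finset.card_sdiff_add_card_eq_card hQG
      omega
    rcases Nat.lt_or_ge (G \ insert z B).card 5 with h5 | h5
    · exact basis_pair_fair_fat_of_card_sdiff_eq_four hG hd hk hs hl hfat hB₀ hD hne hB hnP hz hl0 hw₀ hx
        (by omega)
    · exact basis_pair_fair_fat_of_generic_five hG hd hk hs hl hfat hB₀ hD hne hgen' hB hnP hz hl0 hw₀ hx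
        (by omega)

end PercRepro.Shadow
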